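import Literature.NumberTheory.LFunctions.WeilFirstPrimeCertificateDataA
import Literature.NumberTheory.LFunctions.WeilBlockRows
import HarnessLib

/-!
# First-prime Weil positivity on `C(2/5)`: kernel check of the parity block `1`, rows `0 … 12`

Sibling of `WeilFirstPrimeCertificateDataA.lean`: the odd parity block of
`weilCert2A` passes `WeilCert.checkBlockK` (`D C = I`; `R = S' − UᵀU` diagonally dominant), evaluated
ROW BY ROW (`WeilCert.checkDCRow`, `WeilCert.checkDomRow` of `WeilBlockRows.lean`, one kernel evaluation per
row, run sequentially — `Elab.async false` — to bound memory) and assembled by `WeilCert.checkBlockK_of_rows`.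
-/

set_option Elab.async false

noncomputable section

namespace Literature.NumberTheory.LFunctions

/-- Row `0` of `D C = I`, block `1`. [folklore] -/
theorem weilCert2A_dc1_0 : weilCert2A.base.checkDCRow 1 0 = true := by
  decide +kernel

/-- Row `0` of the dominance test of `R = S' − UᵀU`, block `1`. [folklore] -/
theorem weilCert2A_dom1_0 :
    weilCert2A.base.checkDomRow weilCert2A.nuTab weilCert2A.kappaQ 1 0 = true := by
  decide +kernel

/-- Row `1` of `D C = I`, block `1`. [folklore] -/
theorem weilCert2A_dc1_1 : weilCert2A.base.checkDCRow 1 1 = true := by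
  decide +kernel

/-- Row `1` of the dominance test of `R = S' − UᵀU`, block `1`. [folklore] -/
theorem weilCert2A_dom1_1 :
    weilCert2A.base.checkDomRow weilCert2A.nuTab weilCert2A.kappaQ 1 1 = true := by
  decide +kernel

/-- Row `2` of `D C = I`, block `1`. [folklore] -/
theorem weilCert2A_dc1_2 : weilCert2A.base.checkDCRow 1 2 = true := by
  decide +kernel

/-- Row `2` of the dominance test of `R = S' − UᵀU`, block `1`. [folklore] -/
theorem weilCert2A_dom1_2 :
    weilCert2A.base.checkDomRow weilCert2A.nuTab weilCert2A.kappaQ 1 2 = true := by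
  decide +kernel

/-- Row `3` of `D C = I`, block `1`. [folklore] -/
theorem weilCert2A_dc1_3 : weilCert2A.base.checkDCRow 1 3 = true := by
  decide +kernel

/-- Row `3` of the dominance test of `R = S' − UᵀU`, block `1`. [folklore] -/
theorem weilCert2A_dom1_3 :
    weilCert2A.base.checkDomRow weilCert2A.nuTab weilCert2A.kappaQ 1 3 = true := by
  decide +kernel

/-- Row `4` of `D C = I`, block `1`. [folklore] -/
theorem weilCert2A_dc1_4 : weilCert2A.base.checkDCRow 1 4 = true := by
  decide +kernel

/-- Row `4` of the dominance test of `R = S' − UᵀU`, block `1`. [folklore] -/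
theorem weilCert2A_dom1_4 :
    weilCert2A.base.checkDomRow weilCert2A.nuTab weilCert2A.kappaQ 1 4 = true := by
  decide +kernel

/-- Row `5` of `D C = I`, block `1`. [folklore] -/
theorem weilCert2A_dc1_5 : weilCert2A.base.checkDCRow 1 5 = true := by
  decide +kernel

/-- Row `5` of the dominance test of `R = S' − UᵀU`, block `1`. [folklore] -/
theorem weilCert2A_dom1_5 :
    weilCert2A.base.checkDomRow weilCert2A.nuTab weilCert2A.kappaQ 1 5 = true := by
  decide +kernel

/-- Row `6` of `D C = I`, block `1`. [folklore] -/
theorem weilCert2A_dc1_6 : weilCert2A.base.checkDCRow 1 6 = true := by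
  decide +kernel

/-- Row `6` of the dominance test of `R = S' − UᵀU`, block `1`. [folklore] -/
theorem weilCert2A_dom1_6 :
    weilCert2A.base.checkDomRow weilCert2A.nuTab weilCert2A.kappaQ 1 6 = true := by
  decide +kernel

/-- Row `7` of `D C = I`, block `1`. [folklore] -/
theorem weilCert2A_dc1_7 : weilCert2A.base.checkDCRow 1 7 = true := by
  decide +kernel

/-- Row `7` of the dominance test of `R = S' − UᵀU`, block `1`. [folklore] -/
theorem weilCert2A_dom1_7 :
    weilCert2A.base.checkDomRow weilCert2A.nuTab weilCert2A.kappaQ 1 7 = true := by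
  decide +kernel

/-- Row `8` of `D C = I`, block `1`. [folklore] -/
theorem weilCert2A_dc1_8 : weilCert2A.base.checkDCRow 1 8 = true := by
  decide +kernel

/-- Row `8` of the dominance test of `R = S' − UᵀU`, block `1`. [folklore] -/
theorem weilCert2A_dom1_8 :
    weilCert2A.base.checkDomRow weilCert2A.nuTab weilCert2A.kappaQ 1 8 = true := by
  decide +kernel

/-- Row `9` of `D C = I`, block `1`. [folklore] -/
theorem weilCert2A_dc1_9 : weilCert2A.base.checkDCRow 1 9 = true := by
  decide +kernel

/-- Row `9` of the dominance test of `R = S' − UᵀU`, block `1`. [folklore] -/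
theorem weilCert2A_dom1_9 :
    weilCert2A.base.checkDomRow weilCert2A.nuTab weilCert2A.kappaQ 1 9 = true := by
  decide +kernel

/-- Row `10` of `D C = I`, block `1`. [folklore] -/
theorem weilCert2A_dc1_10 : weilCert2A.base.checkDCRow 1 10 = true := by
  decide +kernel

/-- Row `10` of the dominance test of `R = S' − UᵀU`, block `1`. [folklore] -/
theorem weilCert2A_dom1_10 :
    weilCert2A.base.checkDomRow weilCert2A.nuTab weilCert2A.kappaQ 1 10 = true := by
  decide +kernel

/-- Row `11` of `D C = I`, block `1`. [folklore] -/
theorem weilCert2A_dc1_11 : weilCert2A.base.checkDCRow 1 11 = true := by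
  decide +kernel

/-- Row `11` of the dominance test of `R = S' − UᵀU`, block `1`. [folklore] -/
theorem weilCert2A_dom1_11 :
    weilCert2A.base.checkDomRow weilCert2A.nuTab weilCert2A.kappaQ 1 11 = true := by
  decide +kernel

/-- Row `12` of `D C = I`, block `1`. [folklore] -/
theorem weilCert2A_dc1_12 : weilCert2A.base.checkDCRow 1 12 = true := by
  decide +kernel

/-- Row `12` of the dominance test of `R = S' − UᵀU`, block `1`. [folklore] -/
theorem weilCert2A_dom1_12 :
    weilCert2A.base.checkDomRow weilCert2A.nuTab weilCert2A.kappaQ 1 12 = true := by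
  decide +kernel

end Literature.NumberTheory.LFunctions
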